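import Mathlib
import Summits.QuantumFields.YangMills.Theorems.ConvexGribovBodyContinuumLegGivenGapStubRpCoreChord
import Summits.QuantumFields.YangMills.Theorems.ConvexGribovBodyContinuumLegGivenGapStubRpFormsCS
import Summits.QuantumFields.YangMills.Theorems.ConvexGribovBodyContinuumLegGivenGapStubRpShift
import Literature.MathematicalPhysics.QuantumLattice.WilsonBlockHeatBathLightCone2
import HarnessLib

/-!
# `ContinuumLegGivenGap` (stmt-QuantumFields-15828), line `Sketch` (reshape 17-RP) — `stub_rpCore`, part A:
# reflection-positivity estimates for a positive-time pair on the odd torus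

Support file for the crux item stmt-QuantumFields-15828, stub `stub_rpCore` (registered sub-goal `rpCoreA_main`).
For real bounded measurable cylinder observables `F, G'` of `ℤ⁴` supported on links based at times `0 ≤ x₀ ≤ w`,
on the odd torus of side `2S+1` (`S ≥ 2w + 8`) at `β ≥ 0`, the connected Euclidean-time correlations of the
reflected pairs (`corr(F∘Θ, G'; ·) = latticeConnectedCorr`, `Θ = gaugeTimeReflect`) satisfy:
* `g_F(k) := corr(F∘Θ, F; k) ≥ 0` and `g_F` is LOG-CONVEX for `k ≤ S` (`corr_nonneg`, `corr_logConvex`): by the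
  landed `stub_rpShift` the correlations are values of the bond / site reflection-positive forms of the odd torus
  at centred, shifted observables, and by the landed `stub_rpFormsCS` those forms are symmetric positive
  semi-definite (Cauchy–Schwarz) — odd centres from the bond form, even centres from the site form;
* `corr(F∘Θ, G'; m)² ≤ g_F(m) · g_{G'}(m)` for `m ≤ S` (`corr_sq_le`);
* hence, if `|F|, |G'| ≤ 1` and `g_F(S) ≤ D_F e^{-MS}`, `g_{G'}(S) ≤ D_{G'} e^{-MS}` with `2 log D ≤ M S`, then
  `|corr(F∘Θ, G'; m)| ≤ 2 e^{-(M/2) m}` for all `m ≤ S` (`main`, `rpCoreA_main`) — the log-convex chord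
  (`rpCore_chordBound`) between the free value `g(0) ≤ 2` and the far value `g(S)` ON THE SAME TORUS: the
  clustering constant `D` enters only through `log D / S`, i.e. through a volume threshold.

No definitions; landed tree lemmas only. [folklore]
-/

noncomputable section

namespace Summit.QuantumFields.YangMills.Theorems.ContinuumLegGivenGap

open Filter Topology MeasureTheory
open Literature.MathematicalPhysics.QuantumFieldTheory Literature.MathematicalPhysics.QuantumLattice
  Literature.MathematicalPhysics.AQFT Literature.Probability.LatticeModels

namespace RpCoreA

variable {G : Type} [Group G] [TopologicalSpace G] [IsTopologicalGroup G] [CompactSpace G]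
  [MeasurableSpace G] [BorelSpace G]

/-! ### Shifted, centred observables inherit the hypotheses of `stub_rpFormsCS` -/

omit [Group G] [TopologicalSpace G] [IsTopologicalGroup G] [CompactSpace G] [BorelSpace G] in
/-- A time translate of a cylinder observable minus a constant is a bounded measurable cylinder observable on the
translated support, based at times `0 ≤ x₀ ≤ w + a`. [folklore] -/
theorem shifted_hyps {F : LGConfig 4 G → ℝ} {ΛF : Finset (Literature.MathematicalPhysics.QuantumLattice.ZdEdge 4)} {w : ℕ}
    (hFm : Measurable F) (hFb : ∃ C : ℝ, ∀ U, |F U| ≤ C) (hFc : IsCylinder F ΛF)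
    (htF : ∀ e ∈ ΛF, 0 ≤ e.1 0 ∧ e.1 0 ≤ (w : ℤ)) (a : ℕ) (c : ℝ) :
    Measurable (fun W : LGConfig 4 G => F (configShift (-(Pi.single 0 (a : ℤ))) W) - c) ∧
    (∃ C : ℝ, ∀ U, |(fun W : LGConfig 4 G => F (configShift (-(Pi.single 0 (a : ℤ))) W) - c) U| ≤ C) ∧
    IsCylinder (fun W : LGConfig 4 G => F (configShift (-(Pi.single 0 (a : ℤ))) W) - c)
      (ΛF.image (fun e : Literature.MathematicalPhysics.QuantumLattice.ZdEdge 4 => (e.1 + Pi.single 0 (a : ℤ), e.2))) ∧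
    (∀ e : Literature.MathematicalPhysics.QuantumLattice.ZdEdge 4, e ∈ ΛF.image (fun e : Literature.MathematicalPhysics.QuantumLattice.ZdEdge 4 => (e.1 + Pi.single 0 (a : ℤ), e.2)) →
      0 ≤ e.1 0 ∧ e.1 0 ≤ ((w + a : ℕ) : ℤ)) := by
  refine ⟨(hFm.comp (Literature.MathematicalPhysics.QuantumLattice.configShift _).measurable).sub measurable_const,
    ?_, ?_, ?_⟩
  · obtain ⟨C, hC⟩ := hFb
    exact ⟨C + |c|, fun U => (abs_sub _ _).trans (add_le_add (hC _) le_rfl)⟩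
  · intro U V hUV
    simp only
    congr 1
    refine hFc fun e he => ?_
    have hmem : (e.1 + Pi.single 0 (a : ℤ), e.2) ∈
        (↑(ΛF.image (fun e : Literature.MathematicalPhysics.QuantumLattice.ZdEdge 4 =>
          (e.1 + Pi.single 0 (a : ℤ), e.2))) : Set (Literature.MathematicalPhysics.QuantumLattice.ZdEdge 4)) :=
      Finset.mem_coe.2 (Finset.mem_image_of_mem _ (Finset.mem_coe.1 he))
    have h := hUV _ hmem
    simp only [Literature.MathematicalPhysics.QuantumLattice.configShift_apply]
    convert h using 2 <;> exact Prod.ext (funext fun i => by simp) rfl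
  · intro e he
    obtain ⟨e', he', rfl⟩ := Finset.mem_image.1 he
    obtain ⟨h0, hw⟩ := htF e' he'
    simp only [Pi.add_apply, Pi.single_eq_same]
    push_cast
    omega

variable (r : LatticeRep G) {β : ℝ} (hβ : 0 ≤ β) (S w : ℕ) (hS : 2 * w + 8 ≤ S)
  {F G' : LGConfig 4 G → ℝ} {ΛF ΛG : Finset (Literature.MathematicalPhysics.QuantumLattice.ZdEdge 4)}
  (hFm : Measurable F) (hGm : Measurable G') (hFb : ∃ C : ℝ, ∀ U, |F U| ≤ C) (hGb : ∃ C : ℝ, ∀ U, |G' U| ≤ C)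
  (hFc : IsCylinder F ΛF) (hGc : IsCylinder G' ΛG)
  (htF : ∀ e ∈ ΛF, 0 ≤ e.1 0 ∧ e.1 0 ≤ (w : ℤ)) (htG : ∀ e ∈ ΛG, 0 ≤ e.1 0 ∧ e.1 0 ≤ (w : ℤ))

include hβ hFm hGm hFb hGb hFc hGc htF htG in
/-- **The two Cauchy–Schwarz inequalities and positivity, read on connected correlations**: for `a, b` with
`a + w + 2 ≤ S`, `b + w + 2 ≤ S`,
`corr(F∘Θ, G'; a+b)² ≤ corr(F∘Θ,F; 2a)·corr(G'∘Θ,G'; 2b)`, `corr(F∘Θ, G'; a+b+1)² ≤ corr(F∘Θ,F; 2a+1)·corr(G'∘Θ,G'; 2b+1)`,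
`0 ≤ corr(F∘Θ,F; 2a)`, `0 ≤ corr(F∘Θ,F; 2a+1)` (`stub_rpShift` + `stub_rpFormsCS`). [folklore] -/
theorem cs_corr (a b : ℕ) (ha : a + w + 2 ≤ S) (hb : b + w + 2 ≤ S) :
    latticeConnectedCorr r.ρ β (2 * S + 1) (F ∘ gaugeTimeReflect) G' (a + b) ^ 2 ≤
      latticeConnectedCorr r.ρ β (2 * S + 1) (F ∘ gaugeTimeReflect) F (2 * a) *
        latticeConnectedCorr r.ρ β (2 * S + 1) (G' ∘ gaugeTimeReflect) G' (2 * b) ∧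
    latticeConnectedCorr r.ρ β (2 * S + 1) (F ∘ gaugeTimeReflect) G' (a + b + 1) ^ 2 ≤
      latticeConnectedCorr r.ρ β (2 * S + 1) (F ∘ gaugeTimeReflect) F (2 * a + 1) *
        latticeConnectedCorr r.ρ β (2 * S + 1) (G' ∘ gaugeTimeReflect) G' (2 * b + 1) ∧
    0 ≤ latticeConnectedCorr r.ρ β (2 * S + 1) (F ∘ gaugeTimeReflect) F (2 * a) ∧
    0 ≤ latticeConnectedCorr r.ρ β (2 * S + 1) (F ∘ gaugeTimeReflect) F (2 * a + 1) := by
  -- the centred, shifted observables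
  set cF : ℝ := ∫ V : GaugeConfig 4 (2 * S + 1) G, F (torusLift (2 * S + 1) V) ∂(wilsonMeasure r.ρ β) with hcF
  set cG : ℝ := ∫ V : GaugeConfig 4 (2 * S + 1) G, G' (torusLift (2 * S + 1) V) ∂(wilsonMeasure r.ρ β) with hcG
  obtain ⟨hXm, hXb, hXc, hXt⟩ := shifted_hyps hFm hFb hFc htF a cF
  obtain ⟨hYm, hYb, hYc, hYt⟩ := shifted_hyps hGm hGb hGc htG b cG
  -- common time bound `v := w + max a b`
  have hv : w + max a b + 2 ≤ S := by
    rcases le_total a b with h | h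
    · rw [max_eq_right h]; omega
    · rw [max_eq_left h]; omega
  have hXt' : ∀ e : Literature.MathematicalPhysics.QuantumLattice.ZdEdge 4, e ∈ ΛF.image (fun e : Literature.MathematicalPhysics.QuantumLattice.ZdEdge 4 => (e.1 + Pi.single 0 (a : ℤ), e.2)) →
      0 ≤ e.1 0 ∧ e.1 0 ≤ ((w + max a b : ℕ) : ℤ) := fun e he =>
    ⟨(hXt e he).1, (hXt e he).2.trans (by push_cast; gcongr; exact le_max_left _ _)⟩
  have hYt' : ∀ e : Literature.MathematicalPhysics.QuantumLattice.ZdEdge 4, e ∈ ΛG.image (fun e : Literature.MathematicalPhysics.QuantumLattice.ZdEdge 4 => (e.1 + Pi.single 0 (b : ℤ), e.2)) →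
      0 ≤ e.1 0 ∧ e.1 0 ≤ ((w + max a b : ℕ) : ℤ) := fun e he =>
    ⟨(hYt e he).1, (hYt e he).2.trans (by push_cast; gcongr; exact le_max_right _ _)⟩
  -- Cauchy–Schwarz / positivity of the two forms
  obtain ⟨h1, h2, h3, h4⟩ := stub_rpFormsCS G r β hβ S (w + max a b) hv _ _ _ _ hXm hYm hXb hYb hXc hYc hXt' hYt'
  obtain ⟨-, -, h5, h6⟩ := stub_rpFormsCS G r β hβ S (w + max a b) hv _ _ _ _ hYm hYm hYb hYb hYc hYc hYt' hYt'
  -- the shift identities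
  obtain ⟨eFG0, eFG1⟩ := stub_rpShift G r β S F G' hFm hGm hFb hGb a b
  obtain ⟨eFF0, eFF1⟩ := stub_rpShift G r β S F F hFm hFm hFb hFb a a
  obtain ⟨eGG0, eGG1⟩ := stub_rpShift G r β S G' G' hGm hGm hGb hGb b b
  simp only [← hcF, ← hcG] at eFG0 eFG1 eFF0 eFF1 eGG0 eGG1
  rw [← two_mul] at eFF0 eFF1 eGG0 eGG1
  refine ⟨?_, ?_, ?_, ?_⟩
  · rw [eFG0, eFF0, eGG0]; exact h1
  · rw [eFG1, eFF1, eGG1]; exact h2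
  · rw [eFF0]; exact h3
  · rw [eFF1]; exact h4

include hβ hS hFm hFb hFc htF in
/-- **Positivity**: `corr(F∘Θ, F; k) ≥ 0` for `k ≤ S`. [folklore] -/
theorem corr_nonneg (k : ℕ) (hk : k ≤ S) :
    0 ≤ latticeConnectedCorr r.ρ β (2 * S + 1) (F ∘ gaugeTimeReflect) F k := by
  have ha : k / 2 + w + 2 ≤ S := by omega
  obtain ⟨-, -, h0, h1⟩ := cs_corr r hβ S w hFm hFm hFb hFb hFc hFc htF htF (k / 2) (k / 2) ha ha
  rcases Nat.even_or_odd k with ⟨a, ha'⟩ | ⟨a, ha'⟩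
  · have : 2 * (k / 2) = k := by omega
    rwa [this] at h0
  · have : 2 * (k / 2) + 1 = k := by omega
    rwa [this] at h1

include hβ hS hFm hFb hFc htF in
/-- **Log-convexity**: `corr(F∘Θ, F; k)² ≤ corr(F∘Θ, F; k-1) · corr(F∘Θ, F; k+1)` for `1 ≤ k`, `k + 1 ≤ S`
(odd centres from the bond form, even centres from the site form). [folklore] -/
theorem corr_logConvex (k : ℕ) (hk1 : 1 ≤ k) (hk : k + 1 ≤ S) :
    latticeConnectedCorr r.ρ β (2 * S + 1) (F ∘ gaugeTimeReflect) F k ^ 2 ≤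
      latticeConnectedCorr r.ρ β (2 * S + 1) (F ∘ gaugeTimeReflect) F (k - 1) *
        latticeConnectedCorr r.ρ β (2 * S + 1) (F ∘ gaugeTimeReflect) F (k + 1) := by
  rcases Nat.even_or_odd k with ⟨a, ha'⟩ | ⟨a, ha'⟩
  · -- `k = 2a`, `a ≥ 1`: site form with `(a-1, a)`
    have ha1 : 1 ≤ a := by omega
    have hA : a - 1 + w + 2 ≤ S := by omega
    have hB : a + w + 2 ≤ S := by omega
    obtain ⟨-, h, -, -⟩ := cs_corr r hβ S w hFm hFm hFb hFb hFc hFc htF htF (a - 1) a hA hB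
    have e1 : a - 1 + a + 1 = k := by omega
    have e2 : 2 * (a - 1) + 1 = k - 1 := by omega
    have e3 : 2 * a + 1 = k + 1 := by omega
    rw [e1, e2, e3] at h
    exact h
  · -- `k = 2a+1`: bond form with `(a, a+1)`
    have hA : a + w + 2 ≤ S := by omega
    have hB : a + 1 + w + 2 ≤ S := by omega
    obtain ⟨h, -, -, -⟩ := cs_corr r hβ S w hFm hFm hFb hFb hFc hFc htF htF a (a + 1) hA hB
    have e1 : a + (a + 1) = k := by omega
    have e2 : 2 * a = k - 1 := by omega
    have e3 : 2 * (a + 1) = k + 1 := by omega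
    rw [e1, e2, e3] at h
    exact h

include hβ hS hFm hGm hFb hGb hFc hGc htF htG in
/-- **Off-diagonal by diagonal at the same index**: `corr(F∘Θ, G'; m)² ≤ corr(F∘Θ,F; m) · corr(G'∘Θ,G'; m)` for
`m ≤ S`. [folklore] -/
theorem corr_sq_le (m : ℕ) (hm : m ≤ S) :
    latticeConnectedCorr r.ρ β (2 * S + 1) (F ∘ gaugeTimeReflect) G' m ^ 2 ≤
      latticeConnectedCorr r.ρ β (2 * S + 1) (F ∘ gaugeTimeReflect) F m *
        latticeConnectedCorr r.ρ β (2 * S + 1) (G' ∘ gaugeTimeReflect) G' m := by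
  have ha : m / 2 + w + 2 ≤ S := by omega
  obtain ⟨h0, h1, -, -⟩ := cs_corr r hβ S w hFm hGm hFb hGb hFc hGc htF htG (m / 2) (m / 2) ha ha
  rcases Nat.even_or_odd m with ⟨a, ha'⟩ | ⟨a, ha'⟩
  · have e1 : m / 2 + m / 2 = m := by omega
    have e2 : 2 * (m / 2) = m := by omega
    rw [e1, e2] at h0
    exact h0
  · have e1 : m / 2 + m / 2 + 1 = m := by omega
    have e2 : 2 * (m / 2) + 1 = m := by omega
    rw [e1, e2] at h1
    exact h1

include hβ hS hFm hFb hFc htF in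
/-- **The chord applied to the diagonal correlation**: if `|F| ≤ 1` and the far value is `≤ D e^{-MS}` with
`D ≥ 1`, `2 log D ≤ M S`, then `corr(F∘Θ, F; k) ≤ 2 e^{-(M/2) k}` for all `k ≤ S`. [folklore] -/
theorem corr_diag_le (hF1 : ∀ U, |F U| ≤ 1) {M D : ℝ} (hD : 1 ≤ D) (hDS : 2 * Real.log D ≤ M * S)
    (hfar : latticeConnectedCorr r.ρ β (2 * S + 1) (F ∘ gaugeTimeReflect) F S ≤ D * Real.exp (-(M * S)))
    (k : ℕ) (hk : k ≤ S) :
    latticeConnectedCorr r.ρ β (2 * S + 1) (F ∘ gaugeTimeReflect) F k ≤ 2 * Real.exp (-(M / 2 * k)) := by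
  have hSpos : 0 < S := by omega
  have hSr : (0 : ℝ) < S := by exact_mod_cast hSpos
  have h0 : latticeConnectedCorr r.ρ β (2 * S + 1) (F ∘ gaugeTimeReflect) F 0 ≤ 2 := by
    have h := WilsonBlockHeatBath.abs_latticeConnectedCorr_le_two_mul r β (2 * S + 1)
      (A := F ∘ gaugeTimeReflect) (B := F) (fun U => hF1 _) hF1 0
    have := (abs_le.1 h).2
    linarith
  have hch := rpCore_chordBound (fun k => latticeConnectedCorr r.ρ β (2 * S + 1) (F ∘ gaugeTimeReflect) F k)
    S 2 D M hSpos (by norm_num) hD (fun n hn => corr_nonneg r hβ S w hS hFm hFb hFc htF n hn)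
    (fun n hn1 hn => corr_logConvex r hβ S w hS hFm hFb hFc htF n hn1 hn) h0 hfar k hk
  refine hch.trans ?_
  have hk0 : (0 : ℝ) ≤ k := Nat.cast_nonneg k
  have hexp : -(M * k) + Real.log D / S * k ≤ -(M / 2 * k) := by
    have h1 : Real.log D / S ≤ M / 2 := by
      rw [div_le_iff₀ hSr]
      linarith
    nlinarith
  gcongr

include hβ hS hFm hGm hFb hGb hFc hGc htF htG in
/-- **Part A, main estimate.** If `|F|, |G'| ≤ 1` and the far diagonal values are `≤ D e^{-MS}` (`D ≥ 1`,
`2 log D ≤ M S`), then `|corr(F∘Θ, G'; m)| ≤ 2 e^{-(M/2) m}` for all `m ≤ S`. [folklore] -/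
theorem main (hF1 : ∀ U, |F U| ≤ 1) (hG1 : ∀ U, |G' U| ≤ 1) {M DF DG : ℝ} (hDF : 1 ≤ DF) (hDG : 1 ≤ DG)
    (hDFS : 2 * Real.log DF ≤ M * S) (hDGS : 2 * Real.log DG ≤ M * S)
    (hfarF : latticeConnectedCorr r.ρ β (2 * S + 1) (F ∘ gaugeTimeReflect) F S ≤ DF * Real.exp (-(M * S)))
    (hfarG : latticeConnectedCorr r.ρ β (2 * S + 1) (G' ∘ gaugeTimeReflect) G' S ≤ DG * Real.exp (-(M * S)))
    (m : ℕ) (hm : m ≤ S) :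
    |latticeConnectedCorr r.ρ β (2 * S + 1) (F ∘ gaugeTimeReflect) G' m| ≤ 2 * Real.exp (-(M / 2 * m)) := by
  have hF := corr_diag_le r hβ S w hS hFm hFb hFc htF hF1 hDF hDFS hfarF m hm
  have hG := corr_diag_le r hβ S w hS hGm hGb hGc htG hG1 hDG hDGS hfarG m hm
  have hsq := corr_sq_le r hβ S w hS hFm hGm hFb hGb hFc hGc htF htG m hm
  have hFpos := corr_nonneg r hβ S w hS hFm hFb hFc htF m hm
  refine abs_le_of_sq_le_sq ?_ (by positivity)
  calc latticeConnectedCorr r.ρ β (2 * S + 1) (F ∘ gaugeTimeReflect) G' m ^ 2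
      ≤ latticeConnectedCorr r.ρ β (2 * S + 1) (F ∘ gaugeTimeReflect) F m *
          latticeConnectedCorr r.ρ β (2 * S + 1) (G' ∘ gaugeTimeReflect) G' m := hsq
    _ ≤ (2 * Real.exp (-(M / 2 * m))) * (2 * Real.exp (-(M / 2 * m))) :=
        mul_le_mul hF hG (corr_nonneg r hβ S w hS hGm hGb hGc htG m hm) (by positivity)
    _ = (2 * Real.exp (-(M / 2 * m))) ^ 2 := by ring

end RpCoreA

/-- **Registered sub-goal `rpCoreA_main`** (part A of `stub_rpCore`, stmt-QuantumFields-15828): the main estimate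
`RpCoreA.main` in closed form — for a positive-time pair of real bounded measurable cylinder observables with
`|F|, |G'| ≤ 1` on the odd torus `2S+1`, `S ≥ 2w+8`, `β ≥ 0`, far diagonal values `≤ D e^{-MS}` with `D ≥ 1`,
`2 log D ≤ M S`: `|corr(F∘Θ, G'; m)| ≤ 2 e^{-(M/2) m}` for all `m ≤ S`. [folklore] -/
theorem rpCoreA_main :
    ∀ (G : Type) [Group G] [TopologicalSpace G] [IsTopologicalGroup G] [CompactSpace G]
      [MeasurableSpace G] [BorelSpace G] (r : LatticeRep G) (β : ℝ), 0 ≤ β → ∀ (S w : ℕ), 2 * w + 8 ≤ S →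
      ∀ (F G' : LGConfig 4 G → ℝ) (ΛF ΛG : Finset (Literature.MathematicalPhysics.QuantumLattice.ZdEdge 4)),
      Measurable F → Measurable G' → (∃ C : ℝ, ∀ U, |F U| ≤ C) → (∃ C : ℝ, ∀ U, |G' U| ≤ C) →
      IsCylinder F ΛF → IsCylinder G' ΛG →
      (∀ e ∈ ΛF, 0 ≤ e.1 0 ∧ e.1 0 ≤ (w : ℤ)) → (∀ e ∈ ΛG, 0 ≤ e.1 0 ∧ e.1 0 ≤ (w : ℤ)) →
      (∀ U, |F U| ≤ 1) → (∀ U, |G' U| ≤ 1) → ∀ (M DF DG : ℝ), 1 ≤ DF → 1 ≤ DG →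
      2 * Real.log DF ≤ M * S → 2 * Real.log DG ≤ M * S →
      latticeConnectedCorr r.ρ β (2 * S + 1) (F ∘ gaugeTimeReflect) F S ≤ DF * Real.exp (-(M * S)) →
      latticeConnectedCorr r.ρ β (2 * S + 1) (G' ∘ gaugeTimeReflect) G' S ≤ DG * Real.exp (-(M * S)) →
      ∀ m : ℕ, m ≤ S →
        |latticeConnectedCorr r.ρ β (2 * S + 1) (F ∘ gaugeTimeReflect) G' m| ≤ 2 * Real.exp (-(M / 2 * m)) := by
  intro G _ _ _ _ _ _ r β hβ S w hS F G' ΛF ΛG hFm hGm hFb hGb hFc hGc htF htG hF1 hG1 M DF DG hDF hDG hDFS hDGS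
    hfarF hfarG m hm
  exact RpCoreA.main r hβ S w hS hFm hGm hFb hGb hFc hGc htF htG hF1 hG1 hDF hDG hDFS hDGS hfarF hfarG m hm

end Summit.QuantumFields.YangMills.Theorems.ContinuumLegGivenGap

end
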